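import Summits.ResolutionOfSingularities.ResolutionOfSingularities.Theorems.FrobeniusLadderFInjectiveMacaulayficationTauFloorOneCIChartCM
import HarnessLib

/-!
# Codimension-two complete intersections `k[X₁..Xₙ]/(g₁, g₂)` (`g₁` prime, `g₁ ∤ g₂`) are Cohen–Macaulay at every point
# (crux `FInjectiveMacaulayfication` stmt-ResolutionOfSingularities-15315, chain w45a; generic form of `…TauFloorOneCIChartCM.cmCl_localization` for ALL CI charts of the
# τ-tower (D(y), D(u), D(t), D(z) of floor 1, and later floors); res-L1-w45a-plan-1 R18.10 (ii′) / CHAIN v31.7 «F4POS-1 (d)»; seat res-L1-w45a-stub-1 g10)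

[OURS · L1 W4.5a] Support file (`--supports stmt-ResolutionOfSingularities-15315 --as helper`); def-free, unconditional, ANY field; replaces the role of NO printed
item; NOT a statement of the manuscript; AI-written (AI review is weaker than expert review).

★★ `cmCl_localization_of_prime_of_not_dvd` — for `g₁` prime in `k[X₁..Xₙ]` and `g₂ ∉ (g₁)`, every localisation of `k[X]/(g₁, g₂)` at a prime satisfies the CM clause
`SliceableCentre.CMCl`; ★ `cmCl_stalk_of_prime_of_not_dvd` — the same for every stalk of `Spec (k[X]/(g₁, g₂))`. Proof = `TauFloorOneCIChartCM` §3 with the two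
specimen facts (`prime_g₁`, `not_dvd_g₂`) turned into hypotheses: `k[X]_P` regular ⇒ `/(g₁)` CM (`Fedder.sop_isWeaklyRegular_quotient`) ⇒ `g₂` regular modulo the prime
`(g₁)k[X]_P` ⇒ `/(g₁, g₂)` CM (`cmCl_quotient_pair`) ⇒ transport (`exists_quotLocalizationEquiv`). [folklore; cite: Matsumura1987, Thm. 17.4 (iii)]
-/

-- single-problem summit: the doubled namespace component is forced
set_option linter.dupNamespace false

noncomputable section

open AlgebraicGeometry IsLocalRing RingTheory.Sequence Literature.AlgebraicGeometry.Resolution MvPolynomial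
open scoped Pointwise

namespace Summit.ResolutionOfSingularities.ResolutionOfSingularities.Theorems.FInjectiveMacaulayfication.CICodimTwoCM

open Summit.ResolutionOfSingularities.ResolutionOfSingularities.Theorems.FInjectiveMacaulayfication
open SliceableCentre TauFloorOneCIChartCM

variable (k : Type) [Field k]

set_option maxHeartbeats 800000 in
-- two quotient steps in `k[X]_P` + the quotient/localisation transport
/-- ★★ **Codimension-two complete intersections `k[X₁..Xₙ]/(g₁, g₂)` with `g₁` PRIME and `g₁ ∤ g₂` satisfy the CM clause at every prime** (any field `k`, any `n`):
`k[X]_P` regular ⇒ `k[X]_P/(g₁)` CM (`g₁ ≠ 0`, `Fedder.sop_isWeaklyRegular_quotient`) ⇒ `g₂` regular modulo the PRIME `(g₁)k[X]_P` ⇒ `k[X]_P/(g₁, g₂)` CM (`cmCl_quotient_pair`)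
`≅ (k[X]/(g₁,g₂))_Q` (`exists_quotLocalizationEquiv`). [folklore; cite: Matsumura1987, Thm. 17.4 (iii)] -/
theorem cmCl_localization_of_prime_of_not_dvd {n : ℕ} (g₁ g₂ : MvPolynomial (Fin n) k) (hg₁ : Prime g₁) (hg₂ : ¬ g₁ ∣ g₂)
    (Q : Ideal (MvPolynomial (Fin n) k ⧸ Ideal.span {g₁, g₂})) [Q.IsPrime] : CMCl (Localization.AtPrime Q) := by
  classical
  set P : Ideal (MvPolynomial (Fin n) k) := Q.comap (Ideal.Quotient.mk (Ideal.span {g₁, g₂})) with hPdef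
  set Rp := Localization.AtPrime P with hRp
  set alg : MvPolynomial (Fin n) k →+* Rp := algebraMap (MvPolynomial (Fin n) k) Rp with halg
  haveI : IsRegularLocalRing Rp := IsRegularRing.isRegularLocalRing_localization P
  haveI : IsDomain Rp := isDomain_of_isRegularLocalRing Rp
  have hinj : Function.Injective alg := IsLocalization.injective Rp P.primeCompl_le_nonZeroDivisors
  -- `g₁, g₂ ∈ P`
  have hgI : g₁ ∈ Ideal.span {g₁, g₂} ∧ g₂ ∈ Ideal.span {g₁, g₂} := ⟨Ideal.subset_span (Or.inl rfl), Ideal.subset_span (Or.inr rfl)⟩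
  have hg₁P : g₁ ∈ P := by
    rw [hPdef, Ideal.mem_comap, Ideal.Quotient.eq_zero_iff_mem.mpr hgI.1]; exact Q.zero_mem
  have hg₂P : g₂ ∈ P := by
    rw [hPdef, Ideal.mem_comap, Ideal.Quotient.eq_zero_iff_mem.mpr hgI.2]; exact Q.zero_mem
  have hmax : maximalIdeal Rp = P.map alg := (Localization.AtPrime.map_eq_maximalIdeal (I := P)).symm
  have ha₁m : alg g₁ ∈ maximalIdeal Rp := by rw [hmax]; exact Ideal.mem_map_of_mem _ hg₁P
  have ha₂m : alg g₂ ∈ maximalIdeal Rp := by rw [hmax]; exact Ideal.mem_map_of_mem _ hg₂P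
  have ha₁0 : alg g₁ ≠ 0 := fun h => hg₁.ne_zero (hinj (by rw [h, map_zero]))
  -- STEP 1: `Rp/(g₁)` is CM
  have hCM1 : CMCl (Rp ⧸ Ideal.span {alg g₁}) := fun d hd s hs => Fedder.sop_isWeaklyRegular_quotient ha₁m ha₁0 d hd s hs
  -- STEP 2: `g₂` is regular on `Rp/(g₁)`: `(g₁)Rp` is prime and does not contain `g₂`
  have hdisj : Disjoint (P.primeCompl : Set (MvPolynomial (Fin n) k)) (Ideal.span {g₁} : Ideal (MvPolynomial (Fin n) k)) := by
    refine Set.disjoint_left.mpr fun x hx hxI => hx ?_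
    exact (Ideal.span_singleton_le_iff_mem _ |>.mpr hg₁P) hxI
  have hprime1 : (Ideal.span {alg g₁} : Ideal Rp).IsPrime := by
    have h := IsLocalization.isPrime_of_isPrime_disjoint P.primeCompl Rp (Ideal.span {g₁})
      ((Ideal.span_singleton_prime hg₁.ne_zero).mpr hg₁) hdisj
    rwa [Ideal.map_span, Set.image_singleton] at h
  have ha₂not : alg g₂ ∉ (Ideal.span {alg g₁} : Ideal Rp) := by
    intro hmem
    have hcomap := IsLocalization.under_map_of_isPrime_disjoint P.primeCompl Rp
      ((Ideal.span_singleton_prime hg₁.ne_zero).mpr hg₁) hdisj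
    have : g₂ ∈ (Ideal.map alg (Ideal.span {g₁})).under (MvPolynomial (Fin n) k) := by
      rw [Ideal.under_def, Ideal.mem_comap, Ideal.map_span, Set.image_singleton]; exact hmem
    rw [hcomap, Ideal.mem_span_singleton] at this
    exact hg₂ this
  have hcolon : ∀ v : Rp, v * alg g₂ ∈ (Ideal.span {alg g₁} : Ideal Rp) → v ∈ (Ideal.span {alg g₁} : Ideal Rp) :=
    fun v hv => ((hprime1.mem_or_mem hv).resolve_right ha₂not)
  have hreg2 : IsSMulRegular (QuotSMulTop (alg g₁) Rp) (alg g₂) := by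
    have heq : ((alg g₁) • (⊤ : Submodule Rp Rp)) = (Ideal.span {alg g₁} : Ideal Rp) := by
      rw [← Submodule.ideal_span_singleton_smul, smul_eq_mul, Ideal.mul_top]
    change IsSMulRegular (Rp ⧸ ((alg g₁) • (⊤ : Submodule Rp Rp))) (alg g₂)
    rw [heq]
    intro b c hbc
    obtain ⟨b, rfl⟩ := Ideal.Quotient.mk_surjective b
    obtain ⟨c, rfl⟩ := Ideal.Quotient.mk_surjective c
    have hbc' : Ideal.Quotient.mk (Ideal.span {alg g₁}) (alg g₂ * b) = Ideal.Quotient.mk (Ideal.span {alg g₁}) (alg g₂ * c) := by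
      change Ideal.Quotient.mk (Ideal.span {alg g₁}) (alg g₂ • b) = Ideal.Quotient.mk (Ideal.span {alg g₁}) (alg g₂ • c) at hbc
      simpa only [smul_eq_mul] using hbc
    rw [Ideal.Quotient.eq] at hbc' ⊢
    rw [← mul_sub] at hbc'
    exact hcolon _ (by rw [mul_comm]; exact hbc')
  -- STEP 3: `Rp/(g₁, g₂)` is CM; STEP 4: transport to `C_Q`
  have hCM2 : CMCl (Rp ⧸ Ideal.span {alg g₁, alg g₂}) := cmCl_quotient_pair (alg g₁) (alg g₂) ha₁m ha₂m hCM1 hreg2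
  have h2 : (Ideal.span {alg g₁, alg g₂} : Ideal Rp) = (Ideal.span {g₁, g₂}).map alg := by
    rw [Ideal.map_span alg {g₁, g₂}, Set.image_pair]
  obtain ⟨eI⟩ := exists_quotLocalizationEquiv (Ideal.span {g₁, g₂}) Q
  exact FiLocusOpenOfAffine.cmClause_of_ringEquiv ((Ideal.quotEquivOfEq h2).trans eI) hCM2

/-- ★ **Stalk form**: every stalk of `Spec (k[X]/(g₁, g₂))` satisfies the CM clause (`g₁` prime, `g₁ ∤ g₂`). [folklore] -/
theorem cmCl_stalk_of_prime_of_not_dvd {n : ℕ} (g₁ g₂ : MvPolynomial (Fin n) k) (hg₁ : Prime g₁) (hg₂ : ¬ g₁ ∣ g₂)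
    (w : Spec (.of (MvPolynomial (Fin n) k ⧸ Ideal.span {g₁, g₂}))) :
    CMCl ((Spec (.of (MvPolynomial (Fin n) k ⧸ Ideal.span {g₁, g₂}))).presheaf.stalk w) :=
  GermOfGlobalBlowup.cmCl_stalk_Spec_of_cmCl_localization w (cmCl_localization_of_prime_of_not_dvd k g₁ g₂ hg₁ hg₂ w.asIdeal)

end Summit.ResolutionOfSingularities.ResolutionOfSingularities.Theorems.FInjectiveMacaulayfication.CICodimTwoCM

end
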